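/-
Copyright (c) 2026 the pub-hodgecm-mathlib formalisation cell (harness21).  Prover seat hodgecm-mathlib-R90-CS-p03 (g2), R90-TF section S8 «ContSpec-n½» (taken by default after
(a-2b), dealer R90-CS-plan (g3); file (a-3)): ★ F5's HOLOMORPHY LETTER `hA` for the χ-intertwining amplitude of `U(2,1)_{L∕L⁺}` — every χ-weighted local factor (finite, at EVERY place, and
archimedean) is holomorphic on `{1 < Re z}`, for every weight of modulus `≤ 1`.
-/
import Summits.HodgeConjecture.HodgeConjecture.Theorems.K2E1IntertwiningLocalFactorHolomorphicU3   -- ★ spherical twin (K2E2-p12); brings ★ window engine `K2E1WhittakerTokenWindowU3`, ★ (C) `integrable_localHeight_rpow_neg`, ★ `continuous_localHeight`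
import Summits.HodgeConjecture.HodgeConjecture.Theorems.K2E1IntertwiningArchFactorIntegrableU3    -- ★ `one_le_arch`, `continuous_arch_rpow_neg`, `integrable_arch_rpow_neg_prod_real` (every `σ > 1`)
import HarnessLib

/-!
# K2·E1 ∕ R90·S8 — `K2E1ChiIntertwiningLocalFactorHolomorphicU3` (file (a-3)): THE χ-WEIGHTED LOCAL FACTORS OF THE `U(2,1)` INTERTWINING AMPLITUDE ARE HOLOMORPHIC ON `{1 < Re z}` —
# finite places (ALL of them, no arithmetic hypothesis), the archimedean double integral, and ★ F5's letter `hA` for the (a-2b) amplitude `A(z) = C·(∫∫ ω_∞·ARCH₃^{−z})·∏_{v∈S₀} m_v(z)`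

Cell `pub/hodgecm-mathlib`, crux h413 = `stmt-HodgeConjecture-24833`, route of record `HCCMUnconditional`; R90-TF section S8 «ContSpec-n½», road R2-χ₃ (the (V) scalar road: ★ F5
`K2E1ChiScatteringMiddlePoleU3` takes `(A) (hA : DifferentiableOn ℂ A {z | 1 < z.re}) (hsrc : q z = A z · c_χ^S(z))`; ★ (a-2b) `K2E1ChiIntertwiningScalarEulerProductU3` IS `hsrc`'s shape with
`A z := C · (∫_{L_∞}∫_{L⁺_∞} Ainf_z) · ∏_{v∈S₀} ν_v(𝒪_v³)⁻¹ • ∫ ω_v·Q_v^{−z}`, `Ainf_z = ω_∞·ARCH₃^{−z}`; THIS FILE pays `hA` for that `A`).  THEOREMS ONLY (no `def`, no `instance`, no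
notation, no named-fact hypothesis, no `sorry`; default heartbeats); lane `--supports stmt-HodgeConjecture-24833 --as helper` (count-neutral).  Closes no socket.

THE MATHEMATICS ([Titchmarsh1939] §2.8; [MoeglinWaldspurger1995] II.1.6–II.1.7, IV.1.11; [Langlands1976] Appendix; [Garrett2018] §2.8).  A weighted moment `z ↦ ∫ ω(x)·H(x)^{−z} dm`
with `H ≥ 1`, `‖ω‖ ≤ 1` and `∫ H^{−σ} dm < ∞` for every real `σ > 1` is holomorphic on `{1 < Re z}` (dominated differentiation: ★ `K2E1WhittakerTokenWindowU3.
differentiableOn_integral_cpow_neg_mul_window`).  The `U(2,1)` local height `Q_v ≥ 1` has `∫ Q_v^{−σ} dν_v³ < ∞` for every `σ > 1` at EVERY finite place (★ (C)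
`K2E1IntertwiningLocalFactorBadPlaceSplitU3.integrable_localHeight_rpow_neg` — ramified, `v ∣ 2`, `δ` non-unit alike), and the archimedean factor `ARCH₃ ≥ 1` has
`∫ ARCH₃^{−σ} d(μ_{E,∞}⊗μ_{F,∞}) < ∞` for every `σ > 1` (★ `integrable_arch_rpow_neg_prod_real`).  The weights are the values of a unitary character on the torus part of the
Iwasawa decomposition — a.e.-measurable of modulus `≤ 1` is all that is used.
* §1 **`differentiableOn_integral_chiWeight_mul_localHeight_cpow_neg`** — EVERY finite `v`: `z ↦ ∫ ω_v·Q_v^{−z} dν_v³` holomorphic on `{1 < Re z}`; **`differentiableOn_chiLocalMean_three`**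
  (normalised, ★ (a-1)'s `m_v(z)` bytes); **`differentiableOn_finsetProd_chiLocalMean_three`** (`∏_{v∈S₀}`, Mathlib `DifferentiableOn.fun_finsetProd`).
* §2 **`differentiableOn_integral_archWeight_mul_arch_cpow_neg`** — `z ↦ ∫ ω_∞·ARCH₃^{−z} d(μ_{E,∞}⊗μ_{F,∞})` holomorphic on `{1 < Re z}`; `integrable_archWeight_mul_arch_cpow_neg`;
  **`integral_integral_archWeight_mul_arch_cpow_neg_eq`** (the ITERATED form of ★ (a-2b) `= ` the product form, Fubini); **`differentiableOn_integral_integral_archWeight_mul_arch_cpow_neg`**.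
* §3 HEAD **`differentiableOn_chiAmplitude_three`** — ★ F5's `hA` for `A z := C·(∫ Xi, ∫ a, ω_∞ Xi a·ARCH₃(Xi,a)^{−z})·∏_{v∈S₀} m_v(z)`, letter-free but for the weights' measurability and
  `‖·‖ ≤ 1`.
HONEST SCOPE.  NOT here: ★ F5's `hA32 : A (3∕2) ≠ 0` (non-vanishing of the bad-place χ-means and of the archimedean χ-factor at `z = 3∕2` needs the explicit shell ∕ Beta evaluations
— the spherical ★ `localMean_one_ne_zero`-type positivity arguments do not survive a complex weight), nor `hsrc`'s other letters (★ (a-2b)'s `hfac hT hfin hΩ hin hsp`).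
HONEST LABEL: HC_CM is proved only modulo the 7 printed citations (2 remaining named inputs: hLiu418 = `stmt-HodgeConjecture-24832`, h413 = `stmt-HodgeConjecture-24833`) until rung 0
closes; REL ≠ ★ ≠ BUILT; this file asserts no named fact and closes no socket; count-neutral; unconditional analysis.

## References
* [Titchmarsh1939] E. C. Titchmarsh, *The Theory of Functions*, 2nd ed. (1939): §2.8.
* [MoeglinWaldspurger1995] C. Mœglin, J.-L. Waldspurger, *Spectral Decomposition and Eisenstein Series* (1995): II.1.6–II.1.7, IV.1.11.
* [Langlands1976] R. P. Langlands, *On the Functional Equations Satisfied by Eisenstein Series*, LNM 544 (1976): Appendix (rank one).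
* [Garrett2018] P. Garrett, *Modern Analysis of Automorphic Forms by Example* (2018): §2.8.
-/

set_option autoImplicit false
set_option linter.dupNamespace false -- the mandated namespace repeats `HodgeConjecture.HodgeConjecture`

noncomputable section

open MeasureTheory MeasureTheory.Measure NumberField NumberField.InfinitePlace IsDedekindDomain Filter
open scoped NNReal ENNReal
open Literature.NumberTheory.Automorphic Literature.NumberTheory.Automorphic.UnitaryGroup Literature.NumberTheory.GaloisRepresentations
open Literature.NumberTheory.GaloisRepresentations.IsNonarchimedeanLocalField
open Summit.HodgeConjecture.HodgeConjecture.Cruxes.H413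
open Summit.HodgeConjecture.HodgeConjecture.Cruxes.H413.K2E1WhittakerTokenWindowU3 (differentiableOn_integral_cpow_neg_mul_window)
open Summit.HodgeConjecture.HodgeConjecture.Cruxes.H413.K2E1IntertwiningLocalFactorBadPlaceSplitU3 (integrable_localHeight_rpow_neg)
open Summit.HodgeConjecture.HodgeConjecture.Cruxes.H413.K2E1WhittakerCoefficientEulerProductU3B (continuous_localHeight)
open Summit.HodgeConjecture.HodgeConjecture.Cruxes.H413.K2E1IntertwiningArchFactorIntegrableU3 (one_le_arch continuous_arch_rpow_neg integrable_arch_rpow_neg_prod_real)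

namespace Summit.HodgeConjecture.HodgeConjecture.Cruxes.H413.K2E1ChiIntertwiningLocalFactorHolomorphicU3

variable (L : Type) [Field L] [NumberField L] [IsCMField L] {δ : L} (hcδ : IsCMField.complexConj L δ = -δ) (hδ : δ ≠ 0)
  {d : ↥(maximalRealSubfield L)} (hd : δ * δ = algebraMap ↥(maximalRealSubfield L) L d)

/-! ## §1 Finite places: the χ-weighted local factor is holomorphic on `{1 < Re z}` at EVERY place -/

section Finite

variable (v : HeightOneSpectrum (𝓞 ↥(maximalRealSubfield L)))
  [MeasurableSpace (v.adicCompletion ↥(maximalRealSubfield L))] [BorelSpace (v.adicCompletion ↥(maximalRealSubfield L))] (νv : Measure (v.adicCompletion ↥(maximalRealSubfield L))) [νv.IsAddHaarMeasure]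

include hd in
/-- **`z ↦ ∫ ω_v(p)·Q_v(p)^{−z} dν_v³` IS HOLOMORPHIC ON `{1 < Re z}` AT EVERY FINITE PLACE `v` OF `L⁺`, FOR EVERY a.e.-strongly-measurable weight `ω_v` with `‖ω_v‖ ≤ 1`** (no goodness,
ramification or unit hypothesis on `v`): ★ window engine with `H := Q_v ≥ 1`, `χ := ω_v`, ★ (C) integrability at every `σ > 1`, continuity of `Q_v` ★.  The χ-twin of ★
`K2E1IntertwiningLocalFactorHolomorphicU3.differentiableOn_integral_localHeight_cpow_neg` (`ω_v = 1`). [cite: Garrett2018, §2.8] [cite: MoeglinWaldspurger1995, IV.1.11] -/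
theorem differentiableOn_integral_chiWeight_mul_localHeight_cpow_neg (ω : (Fin 3 → v.adicCompletion ↥(maximalRealSubfield L)) → ℂ)
    (hω : AEStronglyMeasurable ω (Measure.pi fun _ : Fin 3 => νv)) (hωb : ∀ p, ‖ω p‖ ≤ 1) :
    DifferentiableOn ℂ (fun z : ℂ => ∫ p : Fin 3 → v.adicCompletion ↥(maximalRealSubfield L),
      ω p * (((∏ w' : PlacesOver L v, max 1 (max ((normAbs (w'.1.adicCompletion L) (quadraticLocalEquiv L v (IsCMField.complexConj L) hcδ hδ (p 0, p 1) w') : ℝ≥0) : ℝ)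
            ((normAbs (w'.1.adicCompletion L) ((toLocalRing L v (p 2) * algebraMap L (LocalRing L v) δ -
              toLocalRing L v 2⁻¹ * (quadraticLocalEquiv L v (IsCMField.complexConj L) hcδ hδ (p 0, p 1) *
                conjLocal L (IsCMField.complexConj L) v (quadraticLocalEquiv L v (IsCMField.complexConj L) hcδ hδ (p 0, p 1)))) w') : ℝ≥0) : ℝ))) : ℝ) : ℂ) ^ (-z) ∂(Measure.pi fun _ : Fin 3 => νv)) {z : ℂ | 1 < z.re} := by
  haveI : SecondCountableTopology (v.adicCompletion ↥(maximalRealSubfield L)) := secondCountableTopology_localField _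
  have hmeas : ∀ z : ℂ, AEStronglyMeasurable (fun p : Fin 3 → v.adicCompletion ↥(maximalRealSubfield L) =>
      ((((∏ w' : PlacesOver L v, max 1 (max ((normAbs (w'.1.adicCompletion L) (quadraticLocalEquiv L v (IsCMField.complexConj L) hcδ hδ (p 0, p 1) w') : ℝ≥0) : ℝ)
            ((normAbs (w'.1.adicCompletion L) ((toLocalRing L v (p 2) * algebraMap L (LocalRing L v) δ -
              toLocalRing L v 2⁻¹ * (quadraticLocalEquiv L v (IsCMField.complexConj L) hcδ hδ (p 0, p 1) *
                conjLocal L (IsCMField.complexConj L) v (quadraticLocalEquiv L v (IsCMField.complexConj L) hcδ hδ (p 0, p 1)))) w') : ℝ≥0) : ℝ))) : ℝ) : ℂ) ^ (-z)) * ω p) (Measure.pi fun _ : Fin 3 => νv) := fun z => by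
    refine (Continuous.aestronglyMeasurable ?_).mul hω
    refine (Complex.continuous_ofReal.comp (continuous_localHeight L hcδ hδ v)).cpow continuous_const fun p => ?_
    exact Complex.ofReal_mem_slitPlane.2 (lt_of_lt_of_le one_pos (Finset.one_le_prod fun w' _ => le_max_left _ _))
  have h := differentiableOn_integral_cpow_neg_mul_window (Measure.pi fun _ : Fin 3 => νv) (χ := ω)
    (fun p => Finset.one_le_prod fun w' _ => le_max_left _ _) hωb hmeas (fun σ hσ => integrable_localHeight_rpow_neg L hcδ hδ hd v νv hσ)
  refine h.congr fun z _ => ?_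
  exact integral_congr_ae (Eventually.of_forall fun p => mul_comm _ _)

include hd in
/-- **THE NORMALISED χ-LOCAL MEAN `m_v(z) = ν_v(𝒪_v³)⁻¹ • ∫ ω_v·Q_v^{−z}` IS HOLOMORPHIC ON `{1 < Re z}`** (every finite `v`, every a.e.-measurable `‖ω_v‖ ≤ 1`) — ★ (a-1)'s `m_v(z)` bytes
as a function of `z`. [cite: Garrett2018, §2.8] [cite: Langlands1976, Appendix] -/
theorem differentiableOn_chiLocalMean_three (ω : (Fin 3 → v.adicCompletion ↥(maximalRealSubfield L)) → ℂ)
    (hω : AEStronglyMeasurable ω (Measure.pi fun _ : Fin 3 => νv)) (hωb : ∀ p, ‖ω p‖ ≤ 1) :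
    DifferentiableOn ℂ (fun z : ℂ => ((Measure.pi fun _ : Fin 3 => νv) (integralBox ↥(maximalRealSubfield L) (Fin 3) v)).toReal⁻¹ •
      ∫ p : Fin 3 → v.adicCompletion ↥(maximalRealSubfield L),
        ω p * (((∏ w' : PlacesOver L v, max 1 (max ((normAbs (w'.1.adicCompletion L) (quadraticLocalEquiv L v (IsCMField.complexConj L) hcδ hδ (p 0, p 1) w') : ℝ≥0) : ℝ)
            ((normAbs (w'.1.adicCompletion L) ((toLocalRing L v (p 2) * algebraMap L (LocalRing L v) δ -
              toLocalRing L v 2⁻¹ * (quadraticLocalEquiv L v (IsCMField.complexConj L) hcδ hδ (p 0, p 1) *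
                conjLocal L (IsCMField.complexConj L) v (quadraticLocalEquiv L v (IsCMField.complexConj L) hcδ hδ (p 0, p 1)))) w') : ℝ≥0) : ℝ))) : ℝ) : ℂ) ^ (-z) ∂(Measure.pi fun _ : Fin 3 => νv)) {z : ℂ | 1 < z.re} :=
  (differentiableOn_integral_chiWeight_mul_localHeight_cpow_neg L hcδ hδ hd v νv ω hω hωb).const_smul
    (((Measure.pi fun _ : Fin 3 => νv) (integralBox ↥(maximalRealSubfield L) (Fin 3) v)).toReal⁻¹ : ℝ)

end Finite

section FiniteProduct

variable [∀ v : HeightOneSpectrum (𝓞 ↥(maximalRealSubfield L)), MeasurableSpace (v.adicCompletion ↥(maximalRealSubfield L))] [∀ v : HeightOneSpectrum (𝓞 ↥(maximalRealSubfield L)), BorelSpace (v.adicCompletion ↥(maximalRealSubfield L))]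
  (νv : ∀ v : HeightOneSpectrum (𝓞 ↥(maximalRealSubfield L)), Measure (v.adicCompletion ↥(maximalRealSubfield L))) [∀ v, (νv v).IsAddHaarMeasure]
  (S₀ : Finset (HeightOneSpectrum (𝓞 ↥(maximalRealSubfield L))))
  (ω : ∀ v : HeightOneSpectrum (𝓞 ↥(maximalRealSubfield L)), (Fin 3 → v.adicCompletion ↥(maximalRealSubfield L)) → ℂ)

include hd in
/-- **`z ↦ ∏_{v ∈ S₀} m_v(z)` IS HOLOMORPHIC ON `{1 < Re z}`** — the bad-place factor of ★ (a-2b)'s amplitude (§1 at each `v ∈ S₀`, Mathlib `DifferentiableOn.fun_finsetProd`).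
[cite: Garrett2018, §2.8] [cite: MoeglinWaldspurger1995, IV.1.11] -/
theorem differentiableOn_finsetProd_chiLocalMean_three
    (hω : ∀ v ∈ S₀, AEStronglyMeasurable (ω v) (Measure.pi fun _ : Fin 3 => νv v)) (hωb : ∀ v ∈ S₀, ∀ p, ‖ω v p‖ ≤ 1) :
    DifferentiableOn ℂ (fun z : ℂ => ∏ v ∈ S₀, ((Measure.pi fun _ : Fin 3 => νv v) (integralBox ↥(maximalRealSubfield L) (Fin 3) v)).toReal⁻¹ •
      ∫ p : Fin 3 → v.adicCompletion ↥(maximalRealSubfield L),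
        ω v p * (((∏ w' : PlacesOver L v, max 1 (max ((normAbs (w'.1.adicCompletion L) (quadraticLocalEquiv L v (IsCMField.complexConj L) hcδ hδ (p 0, p 1) w') : ℝ≥0) : ℝ)
            ((normAbs (w'.1.adicCompletion L) ((toLocalRing L v (p 2) * algebraMap L (LocalRing L v) δ -
              toLocalRing L v 2⁻¹ * (quadraticLocalEquiv L v (IsCMField.complexConj L) hcδ hδ (p 0, p 1) *
                conjLocal L (IsCMField.complexConj L) v (quadraticLocalEquiv L v (IsCMField.complexConj L) hcδ hδ (p 0, p 1)))) w') : ℝ≥0) : ℝ))) : ℝ) : ℂ) ^ (-z) ∂(Measure.pi fun _ : Fin 3 => νv v)) {z : ℂ | 1 < z.re} :=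
  DifferentiableOn.fun_finsetProd fun v hv => differentiableOn_chiLocalMean_three L hcδ hδ hd v (νv v) (ω v) (hω v hv) (hωb v hv)

end FiniteProduct

/-! ## §2 The archimedean χ-weighted factor -/

section Arch

variable [MeasurableSpace (InfiniteAdeleRing L)] [BorelSpace (InfiniteAdeleRing L)]
  [MeasurableSpace (InfiniteAdeleRing ↥(maximalRealSubfield L))] [BorelSpace (InfiniteAdeleRing ↥(maximalRealSubfield L))]
  (μE₁ : Measure (InfiniteAdeleRing L)) [μE₁.IsAddHaarMeasure] (μF₁ : Measure (InfiniteAdeleRing ↥(maximalRealSubfield L))) [μF₁.IsAddHaarMeasure]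
  (ωinf : InfiniteAdeleRing L → InfiniteAdeleRing ↥(maximalRealSubfield L) → ℂ)

omit [IsCMField L] [MeasurableSpace (InfiniteAdeleRing L)] [BorelSpace (InfiniteAdeleRing L)] [MeasurableSpace (InfiniteAdeleRing ↥(maximalRealSubfield L))] [BorelSpace (InfiniteAdeleRing ↥(maximalRealSubfield L))] in
/-- `ARCH₃` is continuous on `L_∞ × L⁺_∞` (★ `continuous_arch_rpow_neg` at exponent `1`). [folklore] -/
theorem continuous_arch :
    Continuous fun p : InfiniteAdeleRing L × InfiniteAdeleRing ↥(maximalRealSubfield L) => (∏ w : InfinitePlace L, ((1 + ‖(p.1) w‖ ^ 2 / 2) ^ 2 + (w δ) ^ 2 * (((InfiniteAdeleRing.ringEquiv_mixedSpace ↥(maximalRealSubfield L)) p.2).1 ⟨w.comap (algebraMap ↥(maximalRealSubfield L) L), K2E1HeightBigCellLineFormulaU2.isReal_comap_maximalRealSubfield L w⟩) ^ 2)) := by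
  have h := continuous_arch_rpow_neg L (δ := δ) (-1)
  simp only [neg_neg, Real.rpow_one] at h
  exact h

include hδ in
/-- **`z ↦ ∫ ω_∞(p)·ARCH₃(p)^{−z} d(μ_{E,∞} ⊗ μ_{F,∞})` IS HOLOMORPHIC ON `{1 < Re z}`** for every a.e.-strongly-measurable archimedean weight with `‖ω_∞‖ ≤ 1` — ★ window engine with
`H := ARCH₃ ≥ 1` (★ `one_le_arch`), ★ `integrable_arch_rpow_neg_prod_real` at every `σ > 1`. [cite: Titchmarsh1939, §2.8] [cite: MoeglinWaldspurger1995, II.1.7] -/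
theorem differentiableOn_integral_archWeight_mul_arch_cpow_neg
    (hω : AEStronglyMeasurable (fun p : InfiniteAdeleRing L × InfiniteAdeleRing ↥(maximalRealSubfield L) => ωinf p.1 p.2) (μE₁.prod μF₁)) (hωb : ∀ Xi a, ‖ωinf Xi a‖ ≤ 1) :
    DifferentiableOn ℂ (fun z : ℂ => ∫ p : InfiniteAdeleRing L × InfiniteAdeleRing ↥(maximalRealSubfield L),
      ωinf p.1 p.2 * ((((∏ w : InfinitePlace L, ((1 + ‖(p.1) w‖ ^ 2 / 2) ^ 2 + (w δ) ^ 2 * (((InfiniteAdeleRing.ringEquiv_mixedSpace ↥(maximalRealSubfield L)) p.2).1 ⟨w.comap (algebraMap ↥(maximalRealSubfield L) L), K2E1HeightBigCellLineFormulaU2.isReal_comap_maximalRealSubfield L w⟩) ^ 2))) : ℝ) : ℂ) ^ (-z) ∂(μE₁.prod μF₁)) {z : ℂ | 1 < z.re} := by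
  haveI : SecondCountableTopology (InfiniteAdeleRing L) := secondCountableTopology_infiniteAdeleRing L
  haveI : SecondCountableTopology (InfiniteAdeleRing ↥(maximalRealSubfield L)) := secondCountableTopology_infiniteAdeleRing _
  have hmeas : ∀ z : ℂ, AEStronglyMeasurable (fun p : InfiniteAdeleRing L × InfiniteAdeleRing ↥(maximalRealSubfield L) =>
      (((((∏ w : InfinitePlace L, ((1 + ‖(p.1) w‖ ^ 2 / 2) ^ 2 + (w δ) ^ 2 * (((InfiniteAdeleRing.ringEquiv_mixedSpace ↥(maximalRealSubfield L)) p.2).1 ⟨w.comap (algebraMap ↥(maximalRealSubfield L) L), K2E1HeightBigCellLineFormulaU2.isReal_comap_maximalRealSubfield L w⟩) ^ 2))) : ℝ) : ℂ) ^ (-z)) * ωinf p.1 p.2) (μE₁.prod μF₁) := fun z => by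
    refine (Continuous.aestronglyMeasurable ?_).mul hω
    refine (Complex.continuous_ofReal.comp (continuous_arch L (δ := δ))).cpow continuous_const fun p => ?_
    exact Complex.ofReal_mem_slitPlane.2 (lt_of_lt_of_le one_pos (one_le_arch L p.1 p.2))
  have h := differentiableOn_integral_cpow_neg_mul_window (μE₁.prod μF₁) (χ := fun p : InfiniteAdeleRing L × InfiniteAdeleRing ↥(maximalRealSubfield L) => ωinf p.1 p.2)
    (fun p => one_le_arch L p.1 p.2) (fun p => hωb p.1 p.2) hmeas (fun σ hσ => integrable_arch_rpow_neg_prod_real L hδ μE₁ μF₁ hσ)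
  refine h.congr fun z _ => ?_
  exact integral_congr_ae (Eventually.of_forall fun p => mul_comm _ _)

include hδ in
/-- **The weighted archimedean integrand is integrable for `1 < Re z`** (`‖ω_∞·ARCH₃^{−z}‖ ≤ ARCH₃^{−Re z}` ★). [cite: MoeglinWaldspurger1995, II.1.7] -/
theorem integrable_archWeight_mul_arch_cpow_neg
    (hω : AEStronglyMeasurable (fun p : InfiniteAdeleRing L × InfiniteAdeleRing ↥(maximalRealSubfield L) => ωinf p.1 p.2) (μE₁.prod μF₁)) (hωb : ∀ Xi a, ‖ωinf Xi a‖ ≤ 1)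
    {z : ℂ} (hz : 1 < z.re) :
    Integrable (fun p : InfiniteAdeleRing L × InfiniteAdeleRing ↥(maximalRealSubfield L) =>
      ωinf p.1 p.2 * ((((∏ w : InfinitePlace L, ((1 + ‖(p.1) w‖ ^ 2 / 2) ^ 2 + (w δ) ^ 2 * (((InfiniteAdeleRing.ringEquiv_mixedSpace ↥(maximalRealSubfield L)) p.2).1 ⟨w.comap (algebraMap ↥(maximalRealSubfield L) L), K2E1HeightBigCellLineFormulaU2.isReal_comap_maximalRealSubfield L w⟩) ^ 2))) : ℝ) : ℂ) ^ (-z)) (μE₁.prod μF₁) := by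
  haveI : SecondCountableTopology (InfiniteAdeleRing L) := secondCountableTopology_infiniteAdeleRing L
  haveI : SecondCountableTopology (InfiniteAdeleRing ↥(maximalRealSubfield L)) := secondCountableTopology_infiniteAdeleRing _
  have hcont : Continuous fun p : InfiniteAdeleRing L × InfiniteAdeleRing ↥(maximalRealSubfield L) => ((((∏ w : InfinitePlace L, ((1 + ‖(p.1) w‖ ^ 2 / 2) ^ 2 + (w δ) ^ 2 * (((InfiniteAdeleRing.ringEquiv_mixedSpace ↥(maximalRealSubfield L)) p.2).1 ⟨w.comap (algebraMap ↥(maximalRealSubfield L) L), K2E1HeightBigCellLineFormulaU2.isReal_comap_maximalRealSubfield L w⟩) ^ 2))) : ℝ) : ℂ) ^ (-z) := by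
    refine (Complex.continuous_ofReal.comp (continuous_arch L (δ := δ))).cpow continuous_const fun p => ?_
    exact Complex.ofReal_mem_slitPlane.2 (lt_of_lt_of_le one_pos (one_le_arch L p.1 p.2))
  refine Integrable.mono' ((integrable_arch_rpow_neg_prod_real L hδ μE₁ μF₁ hz)) (hω.mul hcont.aestronglyMeasurable) (Eventually.of_forall fun p => ?_)
  rw [norm_mul, Complex.norm_cpow_eq_rpow_re_of_pos (lt_of_lt_of_le one_pos (one_le_arch L p.1 p.2)), Complex.neg_re]
  calc ‖ωinf p.1 p.2‖ * (∏ w : InfinitePlace L, ((1 + ‖(p.1) w‖ ^ 2 / 2) ^ 2 + (w δ) ^ 2 * (((InfiniteAdeleRing.ringEquiv_mixedSpace ↥(maximalRealSubfield L)) p.2).1 ⟨w.comap (algebraMap ↥(maximalRealSubfield L) L), K2E1HeightBigCellLineFormulaU2.isReal_comap_maximalRealSubfield L w⟩) ^ 2)) ^ (-z.re)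
      ≤ 1 * (∏ w : InfinitePlace L, ((1 + ‖(p.1) w‖ ^ 2 / 2) ^ 2 + (w δ) ^ 2 * (((InfiniteAdeleRing.ringEquiv_mixedSpace ↥(maximalRealSubfield L)) p.2).1 ⟨w.comap (algebraMap ↥(maximalRealSubfield L) L), K2E1HeightBigCellLineFormulaU2.isReal_comap_maximalRealSubfield L w⟩) ^ 2)) ^ (-z.re) :=
        mul_le_mul_of_nonneg_right (hωb p.1 p.2) (Real.rpow_nonneg (le_trans zero_le_one (one_le_arch L p.1 p.2)) _)
    _ = _ := one_mul _

include hδ in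
/-- **THE ITERATED ARCHIMEDEAN INTEGRAL OF ★ (a-2b) IS THE PRODUCT-MEASURE ONE** for `1 < Re z` (Fubini, Mathlib `integral_prod`, integrability above). [cite: MoeglinWaldspurger1995, II.1.7] -/
theorem integral_integral_archWeight_mul_arch_cpow_neg_eq
    (hω : AEStronglyMeasurable (fun p : InfiniteAdeleRing L × InfiniteAdeleRing ↥(maximalRealSubfield L) => ωinf p.1 p.2) (μE₁.prod μF₁)) (hωb : ∀ Xi a, ‖ωinf Xi a‖ ≤ 1)
    {z : ℂ} (hz : 1 < z.re) :
    ∫ Xi : InfiniteAdeleRing L, ∫ a : InfiniteAdeleRing ↥(maximalRealSubfield L), ωinf Xi a * ((((∏ w : InfinitePlace L, ((1 + ‖(Xi) w‖ ^ 2 / 2) ^ 2 + (w δ) ^ 2 * (((InfiniteAdeleRing.ringEquiv_mixedSpace ↥(maximalRealSubfield L)) a).1 ⟨w.comap (algebraMap ↥(maximalRealSubfield L) L), K2E1HeightBigCellLineFormulaU2.isReal_comap_maximalRealSubfield L w⟩) ^ 2))) : ℝ) : ℂ) ^ (-z) ∂μF₁ ∂μE₁ =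
      ∫ p : InfiniteAdeleRing L × InfiniteAdeleRing ↥(maximalRealSubfield L), ωinf p.1 p.2 * ((((∏ w : InfinitePlace L, ((1 + ‖(p.1) w‖ ^ 2 / 2) ^ 2 + (w δ) ^ 2 * (((InfiniteAdeleRing.ringEquiv_mixedSpace ↥(maximalRealSubfield L)) p.2).1 ⟨w.comap (algebraMap ↥(maximalRealSubfield L) L), K2E1HeightBigCellLineFormulaU2.isReal_comap_maximalRealSubfield L w⟩) ^ 2))) : ℝ) : ℂ) ^ (-z) ∂(μE₁.prod μF₁) := by
  haveI : SecondCountableTopology (InfiniteAdeleRing L) := secondCountableTopology_infiniteAdeleRing L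
  haveI : SecondCountableTopology (InfiniteAdeleRing ↥(maximalRealSubfield L)) := secondCountableTopology_infiniteAdeleRing _
  exact (integral_prod _ (integrable_archWeight_mul_arch_cpow_neg L hδ μE₁ μF₁ ωinf hω hωb hz)).symm

include hδ in
/-- **`z ↦ ∫_{L_∞} ∫_{L⁺_∞} ω_∞(Ξ,a)·ARCH₃(Ξ,a)^{−z} dμ_{F,∞} dμ_{E,∞}` IS HOLOMORPHIC ON `{1 < Re z}`** (the iterated form, as ★ (a-2b) prints it: product form + Fubini on the open
half-plane). [cite: Titchmarsh1939, §2.8] [cite: MoeglinWaldspurger1995, II.1.7] -/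
theorem differentiableOn_integral_integral_archWeight_mul_arch_cpow_neg
    (hω : AEStronglyMeasurable (fun p : InfiniteAdeleRing L × InfiniteAdeleRing ↥(maximalRealSubfield L) => ωinf p.1 p.2) (μE₁.prod μF₁)) (hωb : ∀ Xi a, ‖ωinf Xi a‖ ≤ 1) :
    DifferentiableOn ℂ (fun z : ℂ => ∫ Xi : InfiniteAdeleRing L, ∫ a : InfiniteAdeleRing ↥(maximalRealSubfield L),
      ωinf Xi a * ((((∏ w : InfinitePlace L, ((1 + ‖(Xi) w‖ ^ 2 / 2) ^ 2 + (w δ) ^ 2 * (((InfiniteAdeleRing.ringEquiv_mixedSpace ↥(maximalRealSubfield L)) a).1 ⟨w.comap (algebraMap ↥(maximalRealSubfield L) L), K2E1HeightBigCellLineFormulaU2.isReal_comap_maximalRealSubfield L w⟩) ^ 2))) : ℝ) : ℂ) ^ (-z) ∂μF₁ ∂μE₁) {z : ℂ | 1 < z.re} :=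
  (differentiableOn_integral_archWeight_mul_arch_cpow_neg L hδ μE₁ μF₁ ωinf hω hωb).congr fun _ hz =>
    integral_integral_archWeight_mul_arch_cpow_neg_eq L hδ μE₁ μF₁ ωinf hω hωb hz

end Arch

/-! ## §3 HEAD: ★ F5's letter `hA` for the (a-2b) amplitude -/

section Amplitude

variable [MeasurableSpace (InfiniteAdeleRing L)] [BorelSpace (InfiniteAdeleRing L)]
  [MeasurableSpace (InfiniteAdeleRing ↥(maximalRealSubfield L))] [BorelSpace (InfiniteAdeleRing ↥(maximalRealSubfield L))]
  (μE₁ : Measure (InfiniteAdeleRing L)) [μE₁.IsAddHaarMeasure] (μF₁ : Measure (InfiniteAdeleRing ↥(maximalRealSubfield L))) [μF₁.IsAddHaarMeasure]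
  [∀ v : HeightOneSpectrum (𝓞 ↥(maximalRealSubfield L)), MeasurableSpace (v.adicCompletion ↥(maximalRealSubfield L))] [∀ v : HeightOneSpectrum (𝓞 ↥(maximalRealSubfield L)), BorelSpace (v.adicCompletion ↥(maximalRealSubfield L))]
  (νv : ∀ v : HeightOneSpectrum (𝓞 ↥(maximalRealSubfield L)), Measure (v.adicCompletion ↥(maximalRealSubfield L))) [∀ v, (νv v).IsAddHaarMeasure]

include hd in
/-- **★ F5's `hA`: THE χ-INTERTWINING AMPLITUDE `A(z) = C · (∫_{L_∞}∫_{L⁺_∞} ω_∞·ARCH₃^{−z}) · ∏_{v ∈ S₀} ν_v(𝒪_v³)⁻¹ • ∫ ω_v·Q_v^{−z}` IS HOLOMORPHIC ON `{1 < Re z}`** — for every constant `C`,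
every bad finset `S₀`, every family of a.e.-measurable finite weights `‖ω_v‖ ≤ 1` (`v ∈ S₀`) and archimedean weight `‖ω_∞‖ ≤ 1`.  This is the `A` of ★ (a-2b)
`exists_pos_inv_measure_smul_integral_eq_chiEulerProduct_three` at `Ainf := fun Xi a => ω_∞ Xi a · ARCH₃(Xi,a)^{−z}`, i.e. the `A` of ★ F5's `hsrc`. [cite: MoeglinWaldspurger1995, IV.1.11]
[cite: Langlands1976, Appendix] [cite: Titchmarsh1939, §2.8] -/
theorem differentiableOn_chiAmplitude_three (C : ℂ) (S₀ : Finset (HeightOneSpectrum (𝓞 ↥(maximalRealSubfield L))))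
    (ω : ∀ v : HeightOneSpectrum (𝓞 ↥(maximalRealSubfield L)), (Fin 3 → v.adicCompletion ↥(maximalRealSubfield L)) → ℂ)
    (hω : ∀ v ∈ S₀, AEStronglyMeasurable (ω v) (Measure.pi fun _ : Fin 3 => νv v)) (hωb : ∀ v ∈ S₀, ∀ p, ‖ω v p‖ ≤ 1)
    (ωinf : InfiniteAdeleRing L → InfiniteAdeleRing ↥(maximalRealSubfield L) → ℂ)
    (hωinf : AEStronglyMeasurable (fun p : InfiniteAdeleRing L × InfiniteAdeleRing ↥(maximalRealSubfield L) => ωinf p.1 p.2) (μE₁.prod μF₁)) (hωinfb : ∀ Xi a, ‖ωinf Xi a‖ ≤ 1) :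
    DifferentiableOn ℂ (fun z : ℂ => C * (∫ Xi : InfiniteAdeleRing L, ∫ a : InfiniteAdeleRing ↥(maximalRealSubfield L),
        ωinf Xi a * ((((∏ w : InfinitePlace L, ((1 + ‖(Xi) w‖ ^ 2 / 2) ^ 2 + (w δ) ^ 2 * (((InfiniteAdeleRing.ringEquiv_mixedSpace ↥(maximalRealSubfield L)) a).1 ⟨w.comap (algebraMap ↥(maximalRealSubfield L) L), K2E1HeightBigCellLineFormulaU2.isReal_comap_maximalRealSubfield L w⟩) ^ 2))) : ℝ) : ℂ) ^ (-z) ∂μF₁ ∂μE₁) *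
      ∏ v ∈ S₀, ((Measure.pi fun _ : Fin 3 => νv v) (integralBox ↥(maximalRealSubfield L) (Fin 3) v)).toReal⁻¹ •
        ∫ p : Fin 3 → v.adicCompletion ↥(maximalRealSubfield L),
          ω v p * (((∏ w' : PlacesOver L v, max 1 (max ((normAbs (w'.1.adicCompletion L) (quadraticLocalEquiv L v (IsCMField.complexConj L) hcδ hδ (p 0, p 1) w') : ℝ≥0) : ℝ)
            ((normAbs (w'.1.adicCompletion L) ((toLocalRing L v (p 2) * algebraMap L (LocalRing L v) δ -
              toLocalRing L v 2⁻¹ * (quadraticLocalEquiv L v (IsCMField.complexConj L) hcδ hδ (p 0, p 1) *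
                conjLocal L (IsCMField.complexConj L) v (quadraticLocalEquiv L v (IsCMField.complexConj L) hcδ hδ (p 0, p 1)))) w') : ℝ≥0) : ℝ))) : ℝ) : ℂ) ^ (-z) ∂(Measure.pi fun _ : Fin 3 => νv v)) {z : ℂ | 1 < z.re} :=
  (((differentiableOn_integral_integral_archWeight_mul_arch_cpow_neg L hδ μE₁ μF₁ ωinf hωinf hωinfb).const_mul C).mul
    (differentiableOn_finsetProd_chiLocalMean_three L hcδ hδ hd νv S₀ ω hω hωb))

end Amplitude

end Summit.HodgeConjecture.HodgeConjecture.Cruxes.H413.K2E1ChiIntertwiningLocalFactorHolomorphicU3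

end
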